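import Summits.Ventures.DiscreteObjects.Hadamard.ConferenceGraph333InvolutionDeviation

/-!
# Involutions of srg(333,166,82,83) fix at most `149` points (kernel; the gen-31 involution window)

Framing: lottery ticket; floor = certified bounds/negative ranges.  Cell pub-namedobj (venture DiscreteObjects),
target (H) = `H(668)`, hadamard gen 31.  Gen 29 proved the window `f ≡ 1 (mod 4)`, `f ≤ 165` for the number `f` of fixed
points of an involution `τ` of `srg(333,166,82,83)` (`⇔` symmetric `C(334)` fixing the border; `ConferenceGraph333InvolutionBound`).
With the deviation-set tools of `ConferenceGraph333InvolutionDeviation` (`|Dev(x)| = 165 − f`; matched same-type pairs have a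
common deviation vertex) a double count closes the gap to **`f ≤ 149`**:
fix a moved `x` of type `ε = S_{x,τx}`; the `(333 − f)/2` moved vertices `z` of type `ε`
(`ConferenceGraph333InvolutionEdges`: moved edges = moved non-edges) other than `x, τx` are either in `Dev(x)` or matched to
`x`, and each matched one has `≥ 2` deviation vertices in common with `x` (`y` and `τy`), while a given `y ∈ Dev(x)` is a
deviation vertex of at most `|Dev(y)| − 2 = 163 − f` of them (`x, τx ∈ Dev(y)` are excluded); hence
`2((333 − f)/2 − 2 − (165 − f)) ≤ (165 − f)(163 − f)`, i.e. `f − 1 ≤ (165 − f)(163 − f)`, which fails for `151 < f ≤ 165`: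
* `invol333_fixed_le_149_seidel` — the Seidel-level statement;
* **`involution_fixed_le_149`** — an involution `τ ≠ 1` of `srg(333,166,82,83)` fixes at most `149` vertices;
* **`involution_window_149`** — `f ≡ 1 (mod 4)` and `f ≤ 149`: `f ∈ {1, 5, 9, …, 149}` (38 values; was 42).
In orbit-matrix words (`w = (333 − f)/2` transposed pairs, each simply joined to exactly `83` others): `(w − 84)² ≥ w/2 − 1`,
so `w ≥ 92`.  CENSUS CONSEQUENCE: the fixed-point window of involutions of a hypothetical srg(333,166,82,83) / symmetric
C(334) is `1 ≤ f ≤ 149`, `f ≡ 1 (mod 4)`.  WORDS: structure of a HYPOTHETICAL object (nothing about H(668) is excluded);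
method = orbit matrices (Behbahani–Lam 2011) in Seidel-vector form; instance and kernel proofs ours (PROVISIONAL).
No `sorry`, no new definitions.
-/

namespace Summit.Ventures.DiscreteObjects.Hadamard

open Finset

section invbound149
variable {V : Type*} [Fintype V] [DecidableEq V]

/-- **Seidel-level bound**: an involution `τ` preserving a Seidel matrix of `srg(333,166,82,83)`, with a moved point,
`f ≡ 1 (mod 4)` and as many moved `z` with `S_{z,τz} = 1` as with `S_{z,τz} = −1`, has `f ≤ 149`. -/
theorem invol333_fixed_le_149_seidel (hV : Fintype.card V = 333) (S : V → V → ℤ) (hSd : ∀ x, S x x = 0)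
    (hSo : ∀ x y, x ≠ y → S x y = 1 ∨ S x y = -1) (hSs : ∀ x y, S y x = S x y) (hS1 : ∀ x, ∑ y, S x y = 0)
    (hSS : ∀ x y, ∑ z, S x z * S z y = 333 * (if x = y then 1 else 0) - 1)
    (τ : Equiv.Perm V) (hτ : ∀ y, τ (τ y) = y) (hSτ : ∀ a b, S (τ a) (τ b) = S a b)
    (hf4 : (univ.filter fun y => τ y = y).card % 4 = 1)
    (hcls : (univ.filter fun z => τ z ≠ z ∧ S z (τ z) = 1).card = (univ.filter fun z => τ z ≠ z ∧ S z (τ z) = -1).card)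
    {x : V} (hx : τ x ≠ x) : (univ.filter fun y => τ y = y).card ≤ 149 := by
  -- deviation sets and their size
  set Dev : V → Finset V := fun u => univ.filter (fun y => (τ y ≠ y ∧ y ≠ u ∧ y ≠ τ u) ∧ S y u = S y (τ u))
    with hDev
  have hDevcard : ∀ {u : V}, τ u ≠ u →
      4 * ((univ.filter fun y => τ y = y).card : ℤ) + 4 * ((Dev u).card : ℤ) = 660 := fun hu =>
    invol333_dev_card S hSd hSo hSs hS1 hSS τ hτ hSτ hu
  -- the type class M of x has (333 − f)/2 elements
  set M := univ.filter (fun z => τ z ≠ z ∧ S z (τ z) = S x (τ x)) with hM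
  have hMcard : 2 * (M.card : ℤ) = 333 - (univ.filter fun y => τ y = y).card := by
    have h := Finset.card_filter_add_card_filter_not (s := (univ : Finset V)) (fun z => τ z = z)
    rw [Finset.card_univ, hV] at h
    have hsp := Finset.card_filter_add_card_filter_not (s := univ.filter fun z => ¬ τ z = z)
      (fun z => S z (τ z) = 1)
    rw [Finset.filter_filter, Finset.filter_filter] at hsp
    have e1 : (univ.filter fun z => ¬ τ z = z ∧ S z (τ z) = 1) = univ.filter fun z => τ z ≠ z ∧ S z (τ z) = 1 :=
      Finset.filter_congr fun z _ => Iff.rfl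
    have e2 : (univ.filter fun z => ¬ τ z = z ∧ ¬ S z (τ z) = 1) = univ.filter fun z => τ z ≠ z ∧ S z (τ z) = -1 := by
      refine Finset.filter_congr fun z _ => ?_
      constructor
      · rintro ⟨hz, hn⟩; exact ⟨hz, (hSo z (τ z) (fun h => hz h.symm)).resolve_left hn⟩
      · rintro ⟨hz, hm⟩; exact ⟨hz, by rw [hm]; norm_num⟩
    rw [e1, e2] at hsp
    rcases hSo x (τ x) (fun h => hx h.symm) with he | he
    · have hMe : M = univ.filter fun z => τ z ≠ z ∧ S z (τ z) = 1 := by rw [hM, he]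
      rw [hMe]; omega
    · have hMe : M = univ.filter fun z => τ z ≠ z ∧ S z (τ z) = -1 := by rw [hM, he]
      rw [hMe]; omega
  -- M' : vertices of the type of x, other than x, τx, matched to x
  set M' := M.filter (fun z => z ≠ x ∧ z ≠ τ x ∧ ¬ S z x = S z (τ x)) with hM'
  have hM'card : (M.card : ℤ) ≤ M'.card + 2 + (Dev x).card := by
    have hsub : M ⊆ M' ∪ ({x, τ x} ∪ Dev x) := by
      intro z hz
      rw [Finset.mem_union, Finset.mem_union, Finset.mem_insert, Finset.mem_singleton]
      by_cases h1 : z = x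
      · exact Or.inr (Or.inl (Or.inl h1))
      by_cases h2 : z = τ x
      · exact Or.inr (Or.inl (Or.inr h2))
      by_cases h3 : S z x = S z (τ x)
      · exact Or.inr (Or.inr ((invol333_mem_dev_iff S τ x z).mpr ⟨⟨(Finset.mem_filter.mp hz).2.1, h1, h2⟩, h3⟩))
      · exact Or.inl (Finset.mem_filter.mpr ⟨hz, h1, h2, h3⟩)
    have h1 := Finset.card_le_card hsub
    have h2 := Finset.card_union_le M' ({x, τ x} ∪ Dev x)
    have h3 := Finset.card_union_le ({x, τ x} : Finset V) (Dev x)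
    have h4 : ({x, τ x} : Finset V).card ≤ 2 := Finset.card_insert_le _ _
    have : M.card ≤ M'.card + 2 + (Dev x).card := by omega
    exact_mod_cast this
  -- each z ∈ M' has ≥ 2 common deviation vertices with x
  have htwo : ∀ z ∈ M', (2 : ℤ) ≤ ((Dev x ∩ Dev z).card : ℤ) := by
    intro z hz
    obtain ⟨hzM, hzx, hzτx, hmatch⟩ := Finset.mem_filter.mp hz
    obtain ⟨hzz, hzt⟩ := (Finset.mem_filter.mp hzM).2
    obtain ⟨y, hyx, hyz⟩ :=
      invol333_matched_common_dev S hSd hSo hSs hS1 hSS τ hτ hSτ hf4 hx hzz hzx hzτx hmatch hzt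
    have hyy : τ y ≠ y := ((invol333_mem_dev_iff S τ x y).mp hyx).1.1
    have hsub : ({y, τ y} : Finset V) ⊆ Dev x ∩ Dev z := by
      intro w hw
      rw [Finset.mem_insert, Finset.mem_singleton] at hw
      rw [Finset.mem_inter]
      rcases hw with rfl | rfl
      · exact ⟨hyx, hyz⟩
      · exact ⟨invol333_dev_tau_mem S hSs τ hτ hSτ hyx, invol333_dev_tau_mem S hSs τ hτ hSτ hyz⟩
    have h := Finset.card_le_card hsub
    rw [Finset.card_pair (fun h => hyy h.symm)] at h
    exact_mod_cast h
  -- double counting the pairs (z, y), z ∈ M', y ∈ Dev x ∩ Dev z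
  have hdc : ∑ z ∈ M', ((Dev x ∩ Dev z).card : ℤ) = ∑ y ∈ Dev x, ((M'.filter fun z => y ∈ Dev z).card : ℤ) := by
    have e1 : ∀ z, ((Dev x ∩ Dev z).card : ℤ) = ∑ y ∈ Dev x, (if y ∈ Dev z then 1 else 0 : ℤ) := by
      intro z
      rw [← Finset.filter_mem_eq_inter, Finset.card_filter, Nat.cast_sum]
      exact Finset.sum_congr rfl fun y _ => by split_ifs <;> simp
    have e2 : ∀ y, ((M'.filter fun z => y ∈ Dev z).card : ℤ) = ∑ z ∈ M', (if y ∈ Dev z then 1 else 0 : ℤ) := by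
      intro y
      rw [Finset.card_filter, Nat.cast_sum]
      exact Finset.sum_congr rfl fun z _ => by split_ifs <;> simp
    rw [Finset.sum_congr rfl fun z _ => e1 z, Finset.sum_congr rfl fun y _ => e2 y, Finset.sum_comm]
  -- each y ∈ Dev x is a deviation vertex of at most |Dev y| − 2 = 163 − f members of M'
  have hinner : ∀ y ∈ Dev x, ((M'.filter fun z => y ∈ Dev z).card : ℤ) ≤
      163 - (univ.filter fun y => τ y = y).card := by
    intro y hy
    have hyy : τ y ≠ y := ((invol333_mem_dev_iff S τ x y).mp hy).1.1
    obtain ⟨hxDy, hτxDy⟩ := invol333_dev_symm S hSs τ hτ hSτ hx hy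
    have hsub : (M'.filter fun z => y ∈ Dev z) ⊆ ((Dev y).erase x).erase (τ x) := by
      intro z hz
      obtain ⟨hzM', hyz⟩ := Finset.mem_filter.mp hz
      obtain ⟨hzM, hzx, hzτx, -⟩ := Finset.mem_filter.mp hzM'
      have hzz : τ z ≠ z := (Finset.mem_filter.mp hzM).2.1
      obtain ⟨hzDy, -⟩ := invol333_dev_symm S hSs τ hτ hSτ hzz hyz
      exact Finset.mem_erase.mpr ⟨hzτx, Finset.mem_erase.mpr ⟨hzx, hzDy⟩⟩
    have h1 : (M'.filter fun z => y ∈ Dev z).card ≤ (((Dev y).erase x).erase (τ x)).card := Finset.card_le_card hsub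
    have hτx' : τ x ∈ (Dev y).erase x := Finset.mem_erase.mpr ⟨fun h => hx h, hτxDy⟩
    have e1 : ((Dev y).erase x).card + 1 = (Dev y).card := Finset.card_erase_add_one hxDy
    have e2 : (((Dev y).erase x).erase (τ x)).card + 1 = ((Dev y).erase x).card := Finset.card_erase_add_one hτx'
    have h3 := hDevcard hyy
    have h4 : ((M'.filter fun z => y ∈ Dev z).card : ℤ) + 2 ≤ ((Dev y).card : ℤ) := by
      have : (M'.filter fun z => y ∈ Dev z).card + 2 ≤ (Dev y).card := by omega
      exact_mod_cast this
    linarith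
  have hsum_le : ∑ y ∈ Dev x, ((M'.filter fun z => y ∈ Dev z).card : ℤ) ≤
      (Dev x).card * (163 - ((univ.filter fun y => τ y = y).card : ℤ)) := by
    have := Finset.sum_le_sum hinner
    rw [Finset.sum_const, nsmul_eq_mul] at this
    exact this
  have hsum_ge : 2 * (M'.card : ℤ) ≤ ∑ z ∈ M', ((Dev x ∩ Dev z).card : ℤ) := by
    have := Finset.sum_le_sum htwo
    rw [Finset.sum_const, nsmul_eq_mul] at this
    linarith
  -- arithmetic
  have hDx := hDevcard hx
  have hf165 : ((univ.filter fun y => τ y = y).card : ℤ) ≤ 165 := by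
    have : (0 : ℤ) ≤ (Dev x).card := by positivity
    linarith
  have hD : ((Dev x).card : ℤ) = 165 - (univ.filter fun y => τ y = y).card := by linarith
  rw [hdc] at hsum_ge
  have hkey : ((univ.filter fun y => τ y = y).card : ℤ) - 1 ≤
      (165 - (univ.filter fun y => τ y = y).card) * (163 - ((univ.filter fun y => τ y = y).card : ℤ)) := by
    nlinarith
  have hf151 : ((univ.filter fun y => τ y = y).card : ℤ) ≤ 151 := by nlinarith
  have hf4' : ((univ.filter fun y => τ y = y).card : ℤ) % 4 = 1 := by exact_mod_cast hf4
  have : ((univ.filter fun y => τ y = y).card : ℤ) ≤ 149 := by omega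
  exact_mod_cast this

/-- **Involutions of `srg(333,166,82,83)` fix at most `149` points.** -/
theorem involution_fixed_le_149 (hV : Fintype.card V = 333) (A : Matrix V V ℤ)
    (h01 : ∀ x y, A x y = 0 ∨ A x y = 1) (hsymm : ∀ x y, A y x = A x y) (hdiag : ∀ x, A x x = 0)
    (hk : ∀ x, ∑ y, A x y = 166) (hsrg : ∀ x y, ∑ z, A x z * A z y = 83 * (1 + (if x = y then 1 else 0)) - A x y)
    (τ : Equiv.Perm V) (hτ : ∀ x, τ (τ x) = x) (hτ1 : τ ≠ 1) (hA : ∀ x y, A (τ x) (τ y) = A x y) :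
    (univ.filter fun x => τ x = x).card ≤ 149 := by
  obtain ⟨hSd, hSo, hSs, hS1, hSS⟩ := seidel_identities_of_conferenceGraph A h01 hsymm hdiag 83
    (by rw [hV]; norm_num) (fun x => by rw [hk x]; norm_num) hsrg
  set S : V → V → ℤ := fun x y => 1 - (if x = y then 1 else 0) - 2 * A x y with hS_def
  have hSS' : ∀ x y, ∑ z, S x z * S z y = 333 * (if x = y then 1 else 0) - 1 := fun x y => by
    rw [hSS x y, hV]; norm_num
  have hSτ : ∀ x y, S (τ x) (τ y) = S x y := fun x y => by
    simp only [hS_def, hA, τ.injective.eq_iff]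
  have hSd' : ∀ x, S x x = 0 := fun x => hSd x
  have hSo' : ∀ x y, x ≠ y → S x y = 1 ∨ S x y = -1 := fun x y => hSo x y
  have hSs' : ∀ x y, S y x = S x y := fun x y => hSs x y
  have hS1' : ∀ x, ∑ y, S x y = 0 := fun x => hS1 x
  have hf4 := involution_fixedPoints_mod_four hV A h01 hsymm hdiag hk hsrg τ hτ hA
  -- the two type classes have equal size (moved edges = moved non-edges)
  have hedges := involution_moved_edges_eq_nonedges hV A h01 hsymm hdiag hk hsrg τ hτ hA
  have hSval : ∀ z, τ z ≠ z → S z (τ z) = 1 - 2 * A z (τ z) := fun z hz => by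
    simp only [hS_def]; rw [if_neg (fun e => hz e.symm)]; ring
  have hcls : (univ.filter fun z => τ z ≠ z ∧ S z (τ z) = 1).card =
      (univ.filter fun z => τ z ≠ z ∧ S z (τ z) = -1).card := by
    have e1 : (univ.filter fun z => τ z ≠ z ∧ S z (τ z) = 1) = univ.filter fun z => τ z ≠ z ∧ A z (τ z) = 0 := by
      refine Finset.filter_congr fun z _ => ?_
      constructor
      · rintro ⟨hz, h⟩
        refine ⟨hz, ?_⟩
        rw [hSval z hz] at h
        rcases h01 z (τ z) with e | e
        · exact e
        · rw [e] at h; norm_num at h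
      · rintro ⟨hz, h⟩
        exact ⟨hz, by rw [hSval z hz, h]; norm_num⟩
    have e2 : (univ.filter fun z => τ z ≠ z ∧ S z (τ z) = -1) = univ.filter fun z => τ z ≠ z ∧ A z (τ z) = 1 := by
      refine Finset.filter_congr fun z _ => ?_
      constructor
      · rintro ⟨hz, h⟩
        refine ⟨hz, ?_⟩
        rw [hSval z hz] at h
        rcases h01 z (τ z) with e | e
        · rw [e] at h; norm_num at h
        · exact e
      · rintro ⟨hz, h⟩
        exact ⟨hz, by rw [hSval z hz, h]; norm_num⟩
    rw [e1, e2, hedges]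
  obtain ⟨x, hx⟩ : ∃ x, τ x ≠ x := by
    by_contra h
    exact hτ1 (Equiv.ext fun y => by by_contra hy; exact h ⟨y, hy⟩)
  exact invol333_fixed_le_149_seidel hV S hSd' hSo' hSs' hS1' hSS' τ hτ hSτ hf4 hcls hx

/-- **Involution window (gen 31).**  An involution `τ ≠ 1` of `srg(333,166,82,83)` has `f ≡ 1 (mod 4)` and `f ≤ 149`
fixed points, i.e. `f ∈ {1, 5, 9, …, 149}`. -/
theorem involution_window_149 (hV : Fintype.card V = 333) (A : Matrix V V ℤ)
    (h01 : ∀ x y, A x y = 0 ∨ A x y = 1) (hsymm : ∀ x y, A y x = A x y) (hdiag : ∀ x, A x x = 0)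
    (hk : ∀ x, ∑ y, A x y = 166) (hsrg : ∀ x y, ∑ z, A x z * A z y = 83 * (1 + (if x = y then 1 else 0)) - A x y)
    (τ : Equiv.Perm V) (hτ : ∀ x, τ (τ x) = x) (hτ1 : τ ≠ 1) (hA : ∀ x y, A (τ x) (τ y) = A x y) :
    (univ.filter fun x => τ x = x).card % 4 = 1 ∧ (univ.filter fun x => τ x = x).card ≤ 149 :=
  ⟨involution_fixedPoints_mod_four hV A h01 hsymm hdiag hk hsrg τ hτ hA,
    involution_fixed_le_149 hV A h01 hsymm hdiag hk hsrg τ hτ hτ1 hA⟩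

end invbound149

end Summit.Ventures.DiscreteObjects.Hadamard
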